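import Summits.BirchSwinnertonDyer.Rank1Residual.SmallImageMu.EulerPrimitiveEdges
import Summits.BirchSwinnertonDyer.Rank1Residual.SmallImageMu.ConjARoadEdges
import Summits.BirchSwinnertonDyer.Rank1Residual.SmallImageMu.KatoDivisibilityEdges
import Summits.BirchSwinnertonDyer.BirchSwinnertonDyer.Theorems.OneSidedTwistSqueezeX9KatoDivisibilityX9StubsOfF1
import Summits.BirchSwinnertonDyer.BirchSwinnertonDyer.Theorems.SmallImageMuTransferMuTransferOfFine
import Summits.BirchSwinnertonDyer.BirchSwinnertonDyer.Theses.SmallImageMuTransfer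
import Summits.BirchSwinnertonDyer.BirchSwinnertonDyer.Theses.OneSidedTwistSqueezeX9
import HarnessLib

set_option autoImplicit false

-- the summit and its single problem are both named `BirchSwinnertonDyer` (registry layout D-0017)
set_option linter.dupNamespace false

/-!
# Route `OneSidedTwistSqueezeX9`, crux `KatoDivisibilityX9` (stmt-BirchSwinnertonDyer-20547) ⟸
# crux `AnalyticMuZeroX9` (stmt-BirchSwinnertonDyer-19630, route `SmallImageMuTransfer`) modulo PRINT,
# as ONE kernel term over landed declarations — two roads

Cell `bsd-f3-mu`, ES lens (planner-bsd-f3-mu-es g13), answering the bookkeeping writer's PRECISION of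
2026-08-27T22:53:45Z («the sentence 19630 ∧ F1 ⟹ 20547 stands as mathematics and as tree theorems + one
routine edge, not yet as ONE kernel theorem»).  It IS one kernel term, twice over, with no new mathematics:

* **ES road (no BCS)** — binders: modularity `hmodP` (`nonempty_modularParametrizationData`, Wiles /
  Taylor–Wiles / BCDT) and F1_ζ (`Kato2004.exists_divisibilityInputs_fineQuotient_zeta`, Kato's Thm. 12.5 (4)
  / 12.6 package with the fine quotient and the span clause):
  19630 ⟹ ES-C2 `EulerPrimitiveOnClassX9` (`SmallImageMu.eulerPrimitiveOnClassX9_of_analyticMuZeroOnClassX9`,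
  Kato §17.13 + GV Prop. 3.7: a unit coefficient of `L_p = Col(z)` puts `z ∉ 𝔭·𝐇¹`) ⟹ Conjecture A on X9
  (`SmallImageMu.conjAOnClassX9_of_eulerPrimitiveOnClassX9`, INPUT-FREE: the kernel core
  `X10.coreTheoremAOddPrime_holds`) ⟹ the crux (LINE A v2 stub 2 `stub_wuthrichUpgradeX9` /
  `katoDivisibilityX9_of_stubs`, p571670, modulo F1 = `SmallImageMu.fineQuotient_of_zeta hfine`).
  So LINE A's one OPEN stub `stub_conjAOnClassX9` is itself ⟸ 19630 ∧ F1_ζ ∧ modularity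
  (`conjAOnClassX9_of_analyticMuZeroX9`).
* **K6 road (no modularity)** — binders: BCS 2025 Thm. 1.1.2 (a) `hBCS`
  (`burungale_castella_skinner_charIdeal_eq_padicLFunction`) and F1_ζ:
  19629 `MuTransfer` modulo F1_ζ (`Theorems.smallImageMuTransfer_MuTransfer_of_fine`, p482919) ∧ 19630
  ⟹ the INTEGRAL main conjecture on X9 (`integralMainConjectureOnClassX9_of_katoMuTransfer`) ⟹ the crux
  (`SmallImageMu.katoDivisibilityOnClassX9_of_integralMainConjectureOnClassX9`, take the generator).
  Per pair and CLASS-FREE (no non-CM, no image-shape input): at every `p ≥ 5` good ordinary pair with `E[p]`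
  irreducible, `μ^an = 0 ⟹` Kato's integral divisibility (`katoDivisibilityAt_of_muAnZeroAt_of_fine`).

Ledger reading: crux 20547 ⟸ crux 19630 modulo {F1_ζ, modularity} and modulo {F1_ζ, BCS (a)}; the
independent content of route (a) `OneSidedTwistSqueezeX9` on the `μ`-side is therefore exactly «Kato's
divisibility on X9 by roads WEAKER than `μ^an = 0`» (FMW rung / first-layer / CM–Katz doors, per pair).
Nothing here decides 19630 (X9: 790 census pairs = 130 5Ns + 36 7Ns + 624 5S4, `μ^an = 0` numerically at
790/790, X9-MU-TABLE v1 361f587418fce70d; no class-wide theorem).  Beyond-print theorem: NO.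
BSD is not proved by any of this.

References: K. Kato, Astérisque 295 (2004), Thm. 12.5/12.6 (p. 222), §13.8, Thm. 17.4 (p. 273), §17.13
(pp. 279–280) [Kato2004Asterisque]; R. Greenberg, V. Vatsal, Invent. Math. 142 (2000) Prop. 3.7
[GreenbergVatsal2000]; A. Burungale, F. Castella, C. Skinner, arXiv:2405.00270v2 Thm. 1.1.2 (a)
[BurungaleCastellaSkinner2025]; C. Breuil, B. Conrad, F. Diamond, R. Taylor, JAMS 14 (2001) [BCDT2001];
J. Coates, R. Sujatha, Math. Ann. 331 (2005) §3 Conjecture A [CoatesSujatha2005].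
-/

noncomputable section

open scoped Classical MatrixGroups ModularForm NumberField
open CongruenceSubgroup WeierstrassCurve Field
open Literature.NumberTheory.GaloisRepresentations
open Literature.NumberTheory.EllipticCurves Literature.NumberTheory.EllipticCurves.ModularForms
open Literature.NumberTheory.EllipticCurves.Kato2004
open Literature.NumberTheory.EllipticCurves.Rank1Residual (MuAnZeroAt MuAlgZeroAt KatoDivisibilityAt)
open Summit.BirchSwinnertonDyer.BirchSwinnertonDyer.Rank1Residual
open Summit.BirchSwinnertonDyer.Rank1Residual.SmallImageMu (ConjAOnClassX9 KatoDivisibilityOnClassX9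
  EulerPrimitiveOnClassX9 eulerPrimitiveOnClassX9_of_analyticMuZeroOnClassX9
  conjAOnClassX9_of_eulerPrimitiveOnClassX9 katoDivisibilityOnClassX9_of_integralMainConjectureOnClassX9
  fineQuotient_of_zeta)
open Summit.BirchSwinnertonDyer.BirchSwinnertonDyer.Theorems.OneSidedTwistSqueezeX9KatoDivisibilityX9Stubs
  (katoDivisibilityX9_of_stubs)
open Summit.BirchSwinnertonDyer.BirchSwinnertonDyer.Theses.OneSidedTwistSqueezeX9 (KatoDivisibilityX9)
open Summit.BirchSwinnertonDyer.BirchSwinnertonDyer.Theses.SmallImageMuTransfer (AnalyticMuZeroX9 MuTransfer)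

namespace Summit.BirchSwinnertonDyer.BirchSwinnertonDyer.Theorems.OneSidedTwistSqueezeX9KatoDivisibilityX9OfAnalyticMuZeroX9

/-- The two route decls ARE the tree nodes. -/
example : KatoDivisibilityX9 = KatoDivisibilityOnClassX9 := rfl
example : AnalyticMuZeroX9 = AnalyticMuZeroOnClassX9 := rfl

/-! ## §1 The ES road: 19630 ∧ F1_ζ ∧ modularity ⟹ ES-C2 ⟹ Conjecture A on X9 ⟹ 20547 (no BCS) -/

/-- **LINE A's open stub from item 19630**: `μ^an = 0` on X9, Kato's fine-quotient package with the span
clause (F1_ζ) and modularity give Coates–Sujatha's Conjecture A at every X9 pair — through Euler-primitivity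
of every Kato §17.13 package at `(p)` (ES-C2) and the input-free kernel core.
[cite: Kato2004Asterisque, Thm. 12.6 (p. 222), §13.8 and §17.13 (pp. 279–280)] [cite: GreenbergVatsal2000, Prop. 3.7]
[cite: CoatesSujatha2005, §3 Conjecture A] -/
theorem conjAOnClassX9_of_analyticMuZeroX9 (hmodP : nonempty_modularParametrizationData)
    (hfine : exists_divisibilityInputs_fineQuotient_zeta) (hA : AnalyticMuZeroX9) : ConjAOnClassX9 :=
  conjAOnClassX9_of_eulerPrimitiveOnClassX9
    (eulerPrimitiveOnClassX9_of_analyticMuZeroOnClassX9 hmodP hfine hA)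

/-- **Crux 20547 from crux 19630, ES road** (modulo modularity and F1_ζ; NO BCS 2025): Conjecture A on X9
(`conjAOnClassX9_of_analyticMuZeroX9`) and LINE A v2's closed stub 2 (`katoDivisibilityX9_of_stubs`, the
Wuthrich upgrade modulo F1 = `SmallImageMu.fineQuotient_of_zeta hfine`, F1_ζ ⟹ F1).
[cite: Kato2004Asterisque, Thm. 17.4 (p. 273) and §17.13 (pp. 279–280)] [cite: Wuthrich2006, Thm. 2 and Lemma 3 (p. 717)] -/
theorem katoDivisibilityX9_of_analyticMuZeroX9 (hmodP : nonempty_modularParametrizationData)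
    (hfine : exists_divisibilityInputs_fineQuotient_zeta) (hA : AnalyticMuZeroX9) : KatoDivisibilityX9 :=
  katoDivisibilityX9_of_stubs (fineQuotient_of_zeta hfine)
    (conjAOnClassX9_of_analyticMuZeroX9 hmodP hfine hA)

/-! ## §2 The K6 road: 19629 mod F1_ζ ∧ 19630 ∧ BCS (a) ⟹ the integral main conjecture on X9 ⟹ 20547
(no modularity) -/

/-- **The INTEGRAL main conjecture on X9 from item 19630 alone, modulo BCS (a) and F1_ζ**: item 19629
(`MuTransfer`) is a tree theorem modulo F1_ζ (`Theorems.smallImageMuTransfer_MuTransfer_of_fine`, p482919),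
and the K6 kernel assembly `integralMainConjectureOnClassX9_of_katoMuTransfer` pins `ch_Λ X(E/ℚ_∞) = (L_p(E))`
at every X9 pair. [cite: BurungaleCastellaSkinner2025, Thm. 1.1.2 (a) (p. 2 of arXiv:2405.00270v2)]
[cite: GreenbergVatsal2000, Prop. 3.7] [cite: Kato2004Asterisque, Thm. 12.6 (p. 222) and §17.13 (pp. 279–280)] -/
theorem integralMainConjectureOnClassX9_of_analyticMuZeroX9
    (hBCS : burungale_castella_skinner_charIdeal_eq_padicLFunction)
    (hfine : exists_divisibilityInputs_fineQuotient_zeta) (hA : AnalyticMuZeroX9) :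
    IntegralMainConjectureOnClassX9 :=
  integralMainConjectureOnClassX9_of_katoMuTransfer hBCS
    (Theorems.smallImageMuTransfer_MuTransfer_of_fine hfine) hA

/-- **Crux 20547 from crux 19630, K6 road** (modulo BCS (a) and F1_ζ; no modularity binder): take the
generator of `ch_Λ X` given by `integralMainConjectureOnClassX9_of_analyticMuZeroX9`.
[cite: BurungaleCastellaSkinner2025, Thm. 1.1.2 (a) (p. 2 of arXiv:2405.00270v2)] [cite: Kato2004Asterisque, Thm. 17.4 (p. 273)] -/
theorem katoDivisibilityX9_of_analyticMuZeroX9_bcs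
    (hBCS : burungale_castella_skinner_charIdeal_eq_padicLFunction)
    (hfine : exists_divisibilityInputs_fineQuotient_zeta) (hA : AnalyticMuZeroX9) : KatoDivisibilityX9 :=
  katoDivisibilityOnClassX9_of_integralMainConjectureOnClassX9
    (integralMainConjectureOnClassX9_of_analyticMuZeroX9 hBCS hfine hA)

/-- **Per pair, CLASS-FREE and IMAGE-FREE**: at every `p ≥ 5` good ordinary pair with `E[p]` irreducible
(surjective, normaliser-of-Cartan and exceptional image alike; CM allowed), `μ^an(E, p) = 0` gives Kato's
integral divisibility `∃ g ∈ ch_Λ X, ι g = L_p(f, α)` for every newform `f` of `E` — modulo BCS (a) and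
F1_ζ: `μ(X) = 0` through the goal's own newform (`Theorems.smallImageMuTransfer_MuTransfer_of_fine`), then
`MuAlgZeroAt.katoDivisibilityAt`. [cite: Kato2004Asterisque, Thm. 12.6 (p. 222), §13.8 and Thm. 17.4 (p. 273)]
[cite: BurungaleCastellaSkinner2025, Thm. 1.1.2 (a) (p. 2 of arXiv:2405.00270v2)] [cite: GreenbergVatsal2000, Prop. 3.7] -/
theorem katoDivisibilityAt_of_muAnZeroAt_of_fine
    (hBCS : burungale_castella_skinner_charIdeal_eq_padicLFunction)
    (hfine : exists_divisibilityInputs_fineQuotient_zeta)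
    {W : WeierstrassCurve ℚ} [W.IsElliptic] [W.IsGloballyMinimal] {p : ℕ} [Fact p.Prime]
    (hp : 5 ≤ p) (hgood : W.HasGoodReductionAtPrime p) (hord : ¬ (p : ℤ) ∣ W.frobeniusTrace p)
    (hirr : W.HasIrreducibleModPGaloisRep p) (hAn : MuAnZeroAt W p) : KatoDivisibilityAt W p := by
  intro κ γ N _ f hκ hγ hγ' hf D
  have hT : KatoMuTransfer := Theorems.smallImageMuTransfer_MuTransfer_of_fine hfine
  have hμ : MuAlgZeroAt W p := fun κ₁ γ₁ hκ₁ hγ₁ hγ₁' D₁ =>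
    hT W p f hp hgood hord hirr hf (hAn f hf) κ₁ γ₁ hκ₁ hγ₁ hγ₁' D₁
  exact hμ.katoDivisibilityAt hBCS hp hgood hord hirr κ γ f hκ hγ hγ' hf D

/-- **The class node by the per-pair engine** (same binders as `katoDivisibilityX9_of_analyticMuZeroX9_bcs`,
through `katoDivisibilityAt_of_muAnZeroAt_of_fine`; recorded to show the class predicate contributes only
`5 ≤ p`, good ordinary and `Irr`). [cite: Kato2004Asterisque, Thm. 17.4 (p. 273)]
[cite: BurungaleCastellaSkinner2025, Thm. 1.1.2 (a) (p. 2 of arXiv:2405.00270v2)] -/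
theorem katoDivisibilityX9_of_analyticMuZeroX9_perPair
    (hBCS : burungale_castella_skinner_charIdeal_eq_padicLFunction)
    (hfine : exists_divisibilityInputs_fineQuotient_zeta) (hA : AnalyticMuZeroX9) : KatoDivisibilityX9 := by
  refine Summit.BirchSwinnertonDyer.Rank1Residual.SmallImageMu.katoDivisibilityOnClassX9_iff.mpr ?_
  intro W _ _ p _ hX9
  obtain ⟨-, hp, hgood, hord, hirr, -⟩ := id hX9
  exact katoDivisibilityAt_of_muAnZeroAt_of_fine hBCS hfine hp hgood hord hirr
    ((Summit.BirchSwinnertonDyer.Rank1Residual.SmallImageMu.analyticMuZeroOnClassX9_iff.mp hA) W p hX9)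

end Summit.BirchSwinnertonDyer.BirchSwinnertonDyer.Theorems.OneSidedTwistSqueezeX9KatoDivisibilityX9OfAnalyticMuZeroX9

end
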